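import Mathlib.CategoryTheory.Endomorphism
import Mathlib.Topology.Algebra.Category.ProfiniteGrp.Basic
import Mathlib.SetTheory.Cardinal.Finite
import HarnessLib

/-!
# Semi-graphs of anabelioids, §§1–3 vocabulary consumed by §4 (localizations) and §5 (arithmetic semi-graphs) — INTERFACE

Mochizuki, *Semi-graphs of anabelioids*, Publ. RIMS **42** (2006) 221–322; locators are pages
of the author's manuscript (kurims, `paper:url-f33ace170ff4`). [cite: MochizukiSemiAnbd2006, §1 pp.11-14; §2 pp.22-26; §3 pp.37-38]

This file is an INTERFACE (`-- TODO-merge: abc-iut-L3-t1` for §§0–2, `abc-iut-L3-t2` for §3).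
Sections 4 and 5 of the paper are written over the vocabulary of §§1–3 (semi-graphs, semi-graphs
of anabelioids, their localizations `G[v]`, `G[e]`, `G[b]`, locally trivial / locally finite
étale / finite étale / tempered morphisms, coherence, elevation, sub-coverticiality, …), which
other seats of the cell are typing from the real definitions.  Until those files land, the
statements of §§4–5 are typed over ONE bundled structure `SemiAnbdVocab` whose fields are

* DATA the printed text manipulates (the ambient category of totally aloof, verticially slim
  semi-graphs of anabelioids and locally open morphisms — which the paper treats "as if they are
  simply morphisms in a category" [Rmk 2.4.2, p.26; with the correction of [IUTchI] Rmk 2.5.3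
  (iii): every edge abuts to at least one vertex] — the underlying semi-graph of an object and
  the underlying morphism of semi-graphs of an arrow [§1 p.11], the localizations
  `G[v]`, `G[e]`, `G[b]` with their natural arrows [§1 p.13, §4 p.50], the verticial degree of
  an arrow at a vertex [Def 4.2 (i)], the outer representation on `Out(π̂₁(G_v))` of the
  automorphisms fixing `v` [Def 5.1 (i)(c)]);
* PREDICATES naming the printed classes of objects and arrows (of injective type, quasi-coherent,
  coherent, totally elevated, totally universally sub-coverticial, totally estranged
  [Defs 2.1, 2.3, 2.4]; locally trivial, locally finite étale [Def 2.2 (ii)], finite étale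
  covering [Def 2.2 (i)], tempered covering [Def 3.5 (ii)]);
* the few FORMAL LAWS §4 uses silently (functoriality of the underlying semi-graph and of
  localization, "locally trivial ⇒ locally finite étale", "finite étale ⇒ tempered ⇒ locally
  finite étale", composites of locally finite étale arrows are locally finite étale).

Nothing here asserts a result of the paper: a field of `SemiAnbdVocab` is either data, a
definitional predicate, or a formal law that holds for the real objects by construction.  The
merge is the definition of one term `SemiAnbdVocab.ofReal` from the §§1–3 files; every
declaration of `Localizations.lean` / `Arithmetic.lean` is parametrised by `(𝓥 : SemiAnbdVocab)`
and specialises to the printed statement at that term.  Purely combinatorial notions of §1 that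
§§4–5 need (closed / open / isolated edges, verticial cardinality, locally finite, untangled,
finite tree, immersion / excision / embedding of the underlying morphism of semi-graphs) are
DEFINED here from the data, in the sub-namespace `SemiAnbdVocab`, so that no name of the §1 file
is shadowed.

Deliberately NOT here: the anabelioid `B(G)` and profinite `π̂₁(G)` of a semi-graph of
anabelioids [§2 pp.22-23], temperoids and `B^temp(G)` [§3] — the statements of §§4–5 that need
them (Prop 4.4 (iii)(iv), Prop 4.5, Thm 4.8, Rmk 4.8.2 (iii), 4.8.4, Prop 5.2 (iii)) are typed in
the companion files over further explicit inputs and say so.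
-/

namespace Literature.AnabelianGeometry.SemiGraphs

open _root_.CategoryTheory

universe u v w

/-- INTERFACE (TODO-merge: abc-iut-L3-t1 §§0–2, abc-iut-L3-t2 §3).  The vocabulary of
[SemiAnbd] §§1–3 over which §4 and §5 are written: an ambient category `Obj` of totally aloof,
verticially slim semi-graphs of anabelioids and locally open morphisms ("we may work with such
morphisms as if they are simply morphisms in a category", Rmk 2.4.2 p.26) — the parameter, any
category — the underlying
semi-graph `(Vert G, Edge G, Br e, abut)` of an object (§1 p.11: vertices, edges = sets of two
branches, coincidence maps to `V ∪ {V}` rendered as `Option (Vert G)`), the underlying morphism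
of semi-graphs of an arrow, localizations `G[v]`, `G[e]`, `G[b]` (§1 p.13, §4 p.50), verticial
degrees (Def 4.2 (i)), the outer representation at a fixed vertex (Def 5.1 (i)(c)), and the
printed classes of objects / arrows of Defs 2.1–2.4, 2.2, 3.5 as predicates, with the formal laws
§4 uses silently. [cite: MochizukiSemiAnbd2006, Rmk 2.4.2, p. 26] -/
structure SemiAnbdVocab (Obj : Type u) [Category.{v} Obj] where
  /-- vertices of the underlying semi-graph (§1 (1) p.11) -/
  Vert : Obj → Type w
  /-- edges of the underlying semi-graph (§1 (2) p.11) -/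
  Edge : Obj → Type w
  /-- the branches of an edge: "a set of cardinality 2" (§1 (2) p.11) -/
  Br : {G : Obj} → Edge G → Type w
  /-- the coincidence map `ζ_e : e → V ∪ {V}` (§1 (3) p.11); `none` = "does not abut to a vertex" -/
  abut : {G : Obj} → {e : Edge G} → Br e → Option (Vert G)
  /-- every edge has exactly two branches (§1 (2) p.11) -/
  natCard_br : ∀ {G : Obj} (e : Edge G), Nat.card (Br e) = 2
  /-- underlying map on vertices of a morphism (§1 p.11) -/
  mapV : {G H : Obj} → (G ⟶ H) → Vert G → Vert H
  /-- underlying map on edges of a morphism (§1 p.11) -/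
  mapE : {G H : Obj} → (G ⟶ H) → Edge G → Edge H
  /-- for each edge `e ↦ e'`, "a bijection `e ⥲ e'`" of branches (§1 p.11) -/
  mapBr : {G H : Obj} → (f : G ⟶ H) → {e : Edge G} → Br e → Br (mapE f e)
  /-- the branch maps are bijections (§1 p.11) -/
  mapBr_bijective : ∀ {G H : Obj} (f : G ⟶ H) (e : Edge G),
    Function.Bijective (mapBr f (e := e))
  /-- compatibility with the verticial restrictions of the coincidence maps (§1 p.11): a branch
  abutting to `v` maps to a branch abutting to the image of `v` (a branch abutting to no vertex
  may map to anything) -/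
  abut_mapBr : ∀ {G H : Obj} (f : G ⟶ H) {e : Edge G} (b : Br e) (v : Vert G),
    abut b = some v → abut (mapBr f b) = some (mapV f v)
  /-- functoriality of the underlying semi-graph: identities -/
  mapV_id : ∀ (G : Obj) (v : Vert G), mapV (𝟙 G) v = v
  /-- functoriality of the underlying semi-graph: composites -/
  mapV_comp : ∀ {G H K : Obj} (f : G ⟶ H) (g : H ⟶ K) (v : Vert G),
    mapV (f ≫ g) v = mapV g (mapV f v)
  /-- functoriality of the underlying semi-graph on edges: identities -/
  mapE_id : ∀ (G : Obj) (e : Edge G), mapE (𝟙 G) e = e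
  /-- functoriality of the underlying semi-graph on edges: composites -/
  mapE_comp : ∀ {G H K : Obj} (f : G ⟶ H) (g : H ⟶ K) (e : Edge G),
    mapE (f ≫ g) e = mapE g (mapE f e)
  /-- the localization `G[v] → G` at a vertex, pulled back to a semi-graph of anabelioids
  (§1 p.13, §4 p.50: `G[v] := G_{G[v]}`) -/
  locV : (G : Obj) → Vert G → Obj
  /-- the localization `G[e] → G` at an edge (§1 p.13, §4 p.50) -/
  locE : (G : Obj) → Edge G → Obj
  /-- the localization `G[b] → G` at a branch (§1 p.13, §4 p.50) -/
  locB : (G : Obj) → {e : Edge G} → Br e → Obj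
  /-- the natural morphism `G[v] → G` (§1 p.13) -/
  ιV : (G : Obj) → (v : Vert G) → (locV G v ⟶ G)
  /-- the natural morphism `G[e] → G` (§1 p.13) -/
  ιE : (G : Obj) → (e : Edge G) → (locE G e ⟶ G)
  /-- the natural morphism `G[b] → G` (§1 p.13) -/
  ιB : (G : Obj) → {e : Edge G} → (b : Br e) → (locB G b ⟶ G)
  /-- "if the branch `b` … abuts to `v`, then we have natural morphisms `G[b] → G[v]` over `G`"
  (§1 p.13) -/
  βV : (G : Obj) → {e : Edge G} → (b : Br e) → (v : Vert G) → abut b = some v →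
    (locB G b ⟶ locV G v)
  /-- "… `G[b] → G[e]` over `G`" (§1 p.13) -/
  βE : (G : Obj) → {e : Edge G} → (b : Br e) → (locB G b ⟶ locE G e)
  /-- `G[b] → G[v]` is a morphism over `G` -/
  βV_ι : ∀ (G : Obj) {e : Edge G} (b : Br e) (v : Vert G) (h : abut b = some v),
    βV G b v h ≫ ιV G v = ιB G b
  /-- `G[b] → G[e]` is a morphism over `G` -/
  βE_ι : ∀ (G : Obj) {e : Edge G} (b : Br e), βE G b ≫ ιE G e = ιB G b
  /-- "`G[v]` consists of a single vertex `v'`, which maps to `v`" (§1 p.13): that vertex -/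
  centerV : (G : Obj) → (v : Vert G) → Vert (locV G v)
  /-- the distinguished vertex of `G[v]` maps to `v` -/
  mapV_centerV : ∀ (G : Obj) (v : Vert G), mapV (ιV G v) (centerV G v) = v
  /-- "`G[e]` consists of a single edge `e'`, which maps to `e`" (§1 p.13): that edge -/
  centerE : (G : Obj) → (e : Edge G) → Edge (locE G e)
  /-- the distinguished edge of `G[e]` maps to `e` -/
  mapE_centerE : ∀ (G : Obj) (e : Edge G), mapE (ιE G e) (centerE G e) = e
  /-- functoriality of localization at vertices: an arrow `f : G → H` with `f(v) = w` induces
  `G[v] → H[w]` (used in Def 4.1 (iv) "the induced morphisms `H[c] → H'[c']`", p.51) -/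
  locMapV : {G H : Obj} → (f : G ⟶ H) → (v : Vert G) → (w : Vert H) → mapV f v = w →
    (locV G v ⟶ locV H w)
  /-- functoriality of localization at edges (Def 4.1 (iv), p.51) -/
  locMapE : {G H : Obj} → (f : G ⟶ H) → (e : Edge G) → (e' : Edge H) → mapE f e = e' →
    (locE G e ⟶ locE H e')
  /-- the induced `G[v] → H[w]` lies over `f` -/
  locMapV_ι : ∀ {G H : Obj} (f : G ⟶ H) (v : Vert G) (w : Vert H) (h : mapV f v = w),
    locMapV f v w h ≫ ιV H w = ιV G v ≫ f
  /-- the induced `G[e] → H[e']` lies over `f` -/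
  locMapE_ι : ∀ {G H : Obj} (f : G ⟶ H) (e : Edge G) (e' : Edge H) (h : mapE f e = e'),
    locMapE f e e' h ≫ ιE H e' = ιE G e ≫ f
  /-- localization at vertices preserves identities -/
  locMapV_id : ∀ (G : Obj) (v : Vert G) (h : mapV (𝟙 G) v = v),
    locMapV (𝟙 G) v v h = 𝟙 (locV G v)
  /-- localization at vertices preserves composites -/
  locMapV_comp : ∀ {G H K : Obj} (f : G ⟶ H) (g : H ⟶ K) (v : Vert G) (w : Vert H)
    (x : Vert K) (h₁ : mapV f v = w) (h₂ : mapV g w = x) (h₃ : mapV (f ≫ g) v = x),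
    locMapV (f ≫ g) v x h₃ = locMapV f v w h₁ ≫ locMapV g w x h₂
  /-- localization at edges preserves identities -/
  locMapE_id : ∀ (G : Obj) (e : Edge G) (h : mapE (𝟙 G) e = e),
    locMapE (𝟙 G) e e h = 𝟙 (locE G e)
  /-- localization at edges preserves composites -/
  locMapE_comp : ∀ {G H K : Obj} (f : G ⟶ H) (g : H ⟶ K) (e : Edge G) (e' : Edge H)
    (e'' : Edge K) (h₁ : mapE f e = e') (h₂ : mapE g e' = e'') (h₃ : mapE (f ≫ g) e = e''),
    locMapE (f ≫ g) e e'' h₃ = locMapE f e e' h₁ ≫ locMapE g e' e'' h₂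
  /-- the verticial degree of an arrow `H → K` at a vertex `v ↦ w`: "the [necessarily finite]
  degree of the finite étale morphism of anabelioids `H_v → K_w` induced by the arrow"
  (Def 4.2 (i), p.52; meaningful for locally finite étale arrows, junk otherwise) -/
  vertDegree : {G H : Obj} → (G ⟶ H) → Vert G → ℕ
  /-- `Out(π̂₁(G_v))` with "the natural profinite group topology" (Def 5.1 (i)(c), p.62), as a
  bundled profinite group; meaningful for coherent `G` (Def 2.3 (iii) p.25: `π̂₁(G_v)`
  topologically finitely generated, "which, as is well-known, implies that `Out(π̂₁(G_c))` is
  equipped with a natural profinite group structure"), junk otherwise -/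
  OutVert : (G : Obj) → Vert G → ProfiniteGrp.{w}
  /-- an automorphism of `G` fixing the vertex `v` induces an automorphism of the anabelioid
  `G_v`, whence an outer automorphism of `π̂₁(G_v)` ("the resulting outer homomorphism
  `H → Out(π̂₁(G_v))`", Def 5.1 (i)(c), p.62) -/
  outRep : {G : Obj} → (φ : Aut G) → (v : Vert G) → mapV φ.hom v = v → OutVert G v
  /-- semi-graphs of anabelioids of injective type: all `b_*` are `π₁`-monomorphisms
  (Def 2.1, p.22) -/
  IsOfInjectiveType : Obj → Prop
  /-- quasi-coherent (Def 2.3 (iii), p.25) -/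
  IsQuasiCoherent : Obj → Prop
  /-- coherent: quasi-coherent with every `π̂₁(G_c)` topologically finitely generated
  (Def 2.3 (iii), p.25) -/
  IsCoherent : Obj → Prop
  /-- "a quasi-coherent `G` is coherent if …" (Def 2.3 (iii), p.25) -/
  isQuasiCoherent_of_isCoherent : ∀ G, IsCoherent G → IsQuasiCoherent G
  /-- totally elevated: every vertex is elevated (Def 2.4 (i), p.25) -/
  IsTotallyElevated : Obj → Prop
  /-- totally universally sub-coverticial (Def 2.4 (iii), p.26) -/
  IsTotallyUnivSubcoverticial : Obj → Prop
  /-- totally estranged: every edge is estranged (Def 2.4 (iv), p.26) -/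
  IsTotallyEstranged : Obj → Prop
  /-- locally trivial morphisms: each induced morphism of constituent anabelioids is an
  isomorphism (Def 2.2 (ii), p.24) -/
  IsLocallyTrivial : {G H : Obj} → (G ⟶ H) → Prop
  /-- locally finite étale morphisms (Def 2.2 (ii), p.24) -/
  IsLocallyFiniteEtale : {G H : Obj} → (G ⟶ H) → Prop
  /-- finite étale coverings `G' → G`, arising from a finite étale covering of anabelioids
  `B(G)_{G'} → B(G)` (Def 2.2 (i), p.24) -/
  IsFiniteEtale : {G H : Obj} → (G ⟶ H) → Prop
  /-- tempered coverings `G' → G` (Def 3.5 (ii), p.37; only defined for countable `G`,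
  cf. [IUTchI] Rmk 2.5.3 (ii) (E5)) -/
  IsTempered : {G H : Obj} → (G ⟶ H) → Prop
  /-- an isomorphism of anabelioids is finite étale: locally trivial ⇒ locally finite étale -/
  isLocallyFiniteEtale_of_isLocallyTrivial : ∀ {G H : Obj} (f : G ⟶ H),
    IsLocallyTrivial f → IsLocallyFiniteEtale f
  /-- finite étale coverings are locally finite étale (constituents of a covering are connected
  components of pull-backs of finite étale coverings of anabelioids, §2 p.23) -/
  isLocallyFiniteEtale_of_isFiniteEtale : ∀ {G H : Obj} (f : G ⟶ H),
    IsFiniteEtale f → IsLocallyFiniteEtale f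
  /-- `B(G) ↪ B^temp(G)`: finite étale coverings are tempered (Def 3.5 (ii), p.37) -/
  isTempered_of_isFiniteEtale : ∀ {G H : Obj} (f : G ⟶ H), IsFiniteEtale f → IsTempered f
  /-- tempered coverings are locally finite étale (Def 3.5 (ii) with Rmk 3.5.2, p.38) -/
  isLocallyFiniteEtale_of_isTempered : ∀ {G H : Obj} (f : G ⟶ H),
    IsTempered f → IsLocallyFiniteEtale f
  /-- identities are locally trivial -/
  isLocallyTrivial_id : ∀ (G : Obj), IsLocallyTrivial (𝟙 G)
  /-- composites of locally finite étale arrows are locally finite étale -/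
  isLocallyFiniteEtale_comp : ∀ {G H K : Obj} (f : G ⟶ H) (g : H ⟶ K),
    IsLocallyFiniteEtale f → IsLocallyFiniteEtale g → IsLocallyFiniteEtale (f ≫ g)
  /-- `G[v] → G` is locally trivial (its constituents are constituents of `G`, §1 p.13 / §2 p.24) -/
  isLocallyTrivial_ιV : ∀ (G : Obj) (v : Vert G), IsLocallyTrivial (ιV G v)
  /-- `G[e] → G` is locally trivial -/
  isLocallyTrivial_ιE : ∀ (G : Obj) (e : Edge G), IsLocallyTrivial (ιE G e)
  /-- `G[b] → G[v]` is locally trivial -/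
  isLocallyTrivial_βV : ∀ (G : Obj) {e : Edge G} (b : Br e) (v : Vert G)
    (h : abut b = some v), IsLocallyTrivial (βV G b v h)
  /-- `G[b] → G[e]` is locally trivial -/
  isLocallyTrivial_βE : ∀ (G : Obj) {e : Edge G} (b : Br e), IsLocallyTrivial (βE G b)
  /-- the induced `G[v] → H[w]` of a locally finite étale arrow is locally finite étale -/
  isLocallyFiniteEtale_locMapV : ∀ {G H : Obj} (f : G ⟶ H) (v : Vert G) (w : Vert H)
    (h : mapV f v = w), IsLocallyFiniteEtale f → IsLocallyFiniteEtale (locMapV f v w h)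
  /-- the induced `G[e] → H[e']` of a locally finite étale arrow is locally finite étale -/
  isLocallyFiniteEtale_locMapE : ∀ {G H : Obj} (f : G ⟶ H) (e : Edge G) (e' : Edge H)
    (h : mapE f e = e'), IsLocallyFiniteEtale f → IsLocallyFiniteEtale (locMapE f e e' h)

namespace SemiAnbdVocab

variable {Obj : Type u} [Category.{v} Obj] (𝓥 : SemiAnbdVocab.{u, v, w} Obj)

/-! ### Combinatorics of the underlying semi-graph (§1 pp.11–14), defined from the data -/

section Combinatorics

/-- The *verticial cardinality* of an edge: the number of its branches that abut to a vertex
(§1 p.11). [cite: MochizukiSemiAnbd2006, §1, p. 11] -/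
noncomputable def vertCard {G : Obj} (e : 𝓥.Edge G) : ℕ :=
  Nat.card {b : 𝓥.Br e // (𝓥.abut b).isSome}

/-- A *closed* edge: verticial cardinality 2, i.e. (both of its two) branches abut to vertices
(§1 p.12). [cite: MochizukiSemiAnbd2006, §1, p. 12] -/
def IsClosedEdge {G : Obj} (e : 𝓥.Edge G) : Prop := ∀ b : 𝓥.Br e, (𝓥.abut b).isSome

/-- An *open* edge: verticial cardinality `< 2` (§1 p.12). [cite: MochizukiSemiAnbd2006, §1, p. 12] -/
def IsOpenEdge {G : Obj} (e : 𝓥.Edge G) : Prop := ¬ 𝓥.IsClosedEdge e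

/-- An *isolated* edge: verticial cardinality `0` (§1 p.12). [cite: MochizukiSemiAnbd2006, §1, p. 12] -/
def IsIsolatedEdge {G : Obj} (e : 𝓥.Edge G) : Prop := ∀ b : 𝓥.Br e, 𝓥.abut b = none

/-- The branches (of all edges) of `G` that abut to the vertex `v`. [cite: MochizukiSemiAnbd2006, §1, p. 11] -/
def BrAt (G : Obj) (v : 𝓥.Vert G) : Type w :=
  {x : Σ e : 𝓥.Edge G, 𝓥.Br e // 𝓥.abut x.2 = some v}

/-- The map induced by an arrow on all branches `(e, b) ↦ (f e, f b)`. [cite: MochizukiSemiAnbd2006, §1, p. 11] -/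
def mapTotalBr {G H : Obj} (f : G ⟶ H) : (Σ e : 𝓥.Edge G, 𝓥.Br e) → Σ e : 𝓥.Edge H, 𝓥.Br e :=
  fun x => ⟨𝓥.mapE f x.1, 𝓥.mapBr f x.2⟩

/-- The map induced by an arrow `f` from the branches abutting to `v` to the branches abutting
to `f(v)` (§1 p.14: "the induced map from branches abutting to `v_A` to branches abutting to
`v_B`"). [cite: MochizukiSemiAnbd2006, §1, p. 14] -/
def mapBrAt {G H : Obj} (f : G ⟶ H) (v : 𝓥.Vert G) : 𝓥.BrAt G v → 𝓥.BrAt H (𝓥.mapV f v) :=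
  fun x => ⟨𝓥.mapTotalBr f x.1, 𝓥.abut_mapBr f x.1.2 v x.2⟩

/-- The underlying morphism of semi-graphs of `f` is an *immersion*: injective on the branches
abutting to each vertex (§1 pp.13–14). [cite: MochizukiSemiAnbd2006, §1, p. 14] -/
def IsGraphImmersion {G H : Obj} (f : G ⟶ H) : Prop :=
  ∀ v : 𝓥.Vert G, Function.Injective (𝓥.mapBrAt f v)

/-- The underlying morphism of semi-graphs of `f` is an *excision*: bijective on the branches
abutting to each vertex (§1 pp.13–14). [cite: MochizukiSemiAnbd2006, §1, p. 14] -/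
def IsGraphExcision {G H : Obj} (f : G ⟶ H) : Prop :=
  ∀ v : 𝓥.Vert G, Function.Bijective (𝓥.mapBrAt f v)

/-- The underlying morphism of semi-graphs of `f` is an *embedding*: "induces an isomorphism of
the domain onto a sub-semi-graph of the codomain" (§1 p.12) — unfolded: injective on vertices and
on edges, and a branch whose image abuts to the image of a vertex `v` already abuts to `v`
(conditions (b), (c) of a sub-semi-graph, p.12). [cite: MochizukiSemiAnbd2006, §1, p. 12] -/
def IsGraphEmbedding {G H : Obj} (f : G ⟶ H) : Prop :=
  Function.Injective (𝓥.mapV f) ∧ Function.Injective (𝓥.mapE f) ∧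
    ∀ (e : 𝓥.Edge G) (b : 𝓥.Br e) (v : 𝓥.Vert G),
      𝓥.abut (𝓥.mapBr f b) = some (𝓥.mapV f v) → 𝓥.abut b = some v

/-- The underlying map on vertices of `f` is injective ("injective on vertices", Def 4.2 (ii)).
[cite: MochizukiSemiAnbd2006, Def 4.2 (ii), p. 52] -/
def IsInjOnVertices {G H : Obj} (f : G ⟶ H) : Prop := Function.Injective (𝓥.mapV f)

/-- `G` is *finite*: finitely many vertices and edges (§1 p.11). [cite: MochizukiSemiAnbd2006, §1, p. 11] -/
def IsFinite (G : Obj) : Prop := Finite (𝓥.Vert G) ∧ Finite (𝓥.Edge G)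

/-- `G` is *countable*: countably many vertices and edges (§1 p.11). [cite: MochizukiSemiAnbd2006, §1, p. 11] -/
def IsCountable (G : Obj) : Prop := Countable (𝓥.Vert G) ∧ Countable (𝓥.Edge G)

/-- `G` is *locally finite*: finitely many edges abut to each vertex (§1 p.13).
[cite: MochizukiSemiAnbd2006, §1, p. 13] -/
def IsLocallyFinite (G : Obj) : Prop := ∀ v : 𝓥.Vert G, Finite (𝓥.BrAt G v)

/-- `G` is *untangled*: every closed edge abuts to two distinct vertices (§1 p.13).
[cite: MochizukiSemiAnbd2006, §1, p. 13] -/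
def IsUntangled (G : Obj) : Prop :=
  ∀ (e : 𝓥.Edge G), 𝓥.IsClosedEdge e → ∀ b₁ b₂ : 𝓥.Br e, b₁ ≠ b₂ → 𝓥.abut b₁ ≠ 𝓥.abut b₂

/-- Adjacency of the underlying semi-graph viewed on its set of components `Vert ⊕ Edge`: a vertex
is adjacent to an edge when some branch of the edge abuts to it (the topological realisation of
§1 pp.11–12 is connected iff this relation generates everything). [cite: MochizukiSemiAnbd2006, §1, p. 12] -/
def Incident (G : Obj) : 𝓥.Vert G ⊕ 𝓥.Edge G → 𝓥.Vert G ⊕ 𝓥.Edge G → Prop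
  | .inl v, .inr e => ∃ b : 𝓥.Br e, 𝓥.abut b = some v
  | .inr e, .inl v => ∃ b : 𝓥.Br e, 𝓥.abut b = some v
  | _, _ => False

/-- `G` is *connected*: its underlying semi-graph is nonempty and any two components are joined by
a chain of incidences (the associated topological space of §1 pp.11–12 is connected; §2 p.22 "the
underlying semi-graph is assumed to be connected"). [cite: MochizukiSemiAnbd2006, §2, p. 22] -/
def IsConnected (G : Obj) : Prop :=
  Nonempty (𝓥.Vert G ⊕ 𝓥.Edge G) ∧
    ∀ x y : 𝓥.Vert G ⊕ 𝓥.Edge G, Relation.EqvGen (𝓥.Incident G) x y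

/-- `G` is a *graph*: every edge is closed (§1 p.11). [cite: MochizukiSemiAnbd2006, §1, p. 11] -/
def IsGraph (G : Obj) : Prop := ∀ e : 𝓥.Edge G, 𝓥.IsClosedEdge e

/-- `G` is a *finite tree*: for a finite connected semi-graph with a vertex, contractibility of
the associated topological space (§1 p.13 "tree") is equivalent to `#vertices = #closed edges + 1`
(the maximal subgraph is a deformation retract, p.13); a connected semi-graph without vertices is
a single isolated edge, whose realisation is an open interval, hence a tree.  Used only for
finite objects (Prop 4.3 (iv), Rmk 4.8.2 (ii)). [cite: MochizukiSemiAnbd2006, §1, p. 13] -/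
def IsFiniteTree (G : Obj) : Prop :=
  𝓥.IsFinite G ∧ 𝓥.IsConnected G ∧
    (Nat.card (𝓥.Vert G) = Nat.card {e : 𝓥.Edge G // 𝓥.IsClosedEdge e} + 1 ∨
      IsEmpty (𝓥.Vert G))

/-- Every edge abuts to at least one vertex — the standing correction of [IUTchI] Rmk 2.5.3 (iii)
(kurims ms p.54) to Rmk 2.4.2, "the second paragraph of §4" and Def 5.1 (iv) of [SemiAnbd].
[cite: Mochizuki2012, IUTchI Rmk 2.5.3 (iii), p. 54] -/
def HasNoIsolatedEdge (G : Obj) : Prop := ∀ e : 𝓥.Edge G, ¬ 𝓥.IsIsolatedEdge e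

end Combinatorics

/-! ### Formal consequences used by §4 -/

section Laws

/-- Identities are locally finite étale. [cite: MochizukiSemiAnbd2006, Def 2.2 (ii), p. 24] -/
theorem isLocallyFiniteEtale_id (G : Obj) : 𝓥.IsLocallyFiniteEtale (𝟙 G) :=
  𝓥.isLocallyFiniteEtale_of_isLocallyTrivial _ (𝓥.isLocallyTrivial_id G)

/-- `G[v] → G` is locally finite étale. [cite: MochizukiSemiAnbd2006, Def 2.2 (ii), p. 24] -/
theorem isLocallyFiniteEtale_ιV (G : Obj) (v : 𝓥.Vert G) : 𝓥.IsLocallyFiniteEtale (𝓥.ιV G v) :=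
  𝓥.isLocallyFiniteEtale_of_isLocallyTrivial _ (𝓥.isLocallyTrivial_ιV G v)

/-- `G[e] → G` is locally finite étale. [cite: MochizukiSemiAnbd2006, Def 2.2 (ii), p. 24] -/
theorem isLocallyFiniteEtale_ιE (G : Obj) (e : 𝓥.Edge G) : 𝓥.IsLocallyFiniteEtale (𝓥.ιE G e) :=
  𝓥.isLocallyFiniteEtale_of_isLocallyTrivial _ (𝓥.isLocallyTrivial_ιE G e)

end Laws

end SemiAnbdVocab

end Literature.AnabelianGeometry.SemiGraphs
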